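import Literature.Geometry.Riemannian.UniformNearLevel
import Mathlib.Analysis.Calculus.MeanValue
import Mathlib.Analysis.Calculus.ContDiff.Basic
import Mathlib.Analysis.InnerProductSpace.Basic
import Mathlib.Analysis.Normed.Module.FiniteDimension
import HarnessLib

/-!
# Slices of a `C¹` map near the level `σ = 1`: small Lipschitz constants in `u`

Topic `Geometry/Riemannian` (elementary calculus). Let `Φ : ℝ × V → W` be `C¹` on the open set
`(1-ε, 1+ε) × (V ∖ {0})` and vanish at `σ = 1`. Then the `u`-derivative of `Φ` is continuous and
vanishes at `σ = 1`, so it is uniformly small on `[1-ε₁, 1+ε₁] × {1/2 ≤ ‖u‖ ≤ 3/2}`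
(`UniformNearLevel.lean`), and by the mean value inequality on segments between close unit
vectors (which stay in that shell):

* `exists_forall_slice_sub_le_near_one` — **for every `κ > 0` there is `ε₁ ∈ (0, ε)` with
  `‖Φ(σ, u') - Φ(σ, u)‖ ≤ κ ‖u' - u‖` for `|σ - 1| ≤ ε₁` and unit `u, u'` with `‖u - u'‖ < 1`;**
* `exists_forall_sub_le_mul_abs_sub` — a bounded Lipschitz constant in `σ` on
  `[1-ε/2, 1+ε/2] × sphere` (no vanishing needed).

This is the form in which the angular drift and the radial defect of the collar cone map enter the
shell lemma (`PolarGraphInjective.lean`) in the interior surgery of Weinstein's disk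
(Weinstein 1968, proof of the main theorem, step (3)).

## References

* A. Weinstein, Ann. of Math. (2) 87 (1968), 29–41. [cite: Weinstein1968]

Tags: [MeanValueInequality] [Weinstein1968]
-/

noncomputable section

open Set Function Metric Filter
open scoped Topology

namespace Literature.Geometry.Riemannian

variable {V : Type*} [NormedAddCommGroup V] [InnerProductSpace ℝ V] [FiniteDimensional ℝ V]
  {W : Type*} [NormedAddCommGroup W] [NormedSpace ℝ W]

omit [FiniteDimensional ℝ V] in
/-- The segment between two unit vectors at distance `< 1` stays in the shell
`{1/2 ≤ ‖x‖ ≤ 3/2}`. [folklore] -/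
theorem segment_subset_shell {u u' : V} (hu : ‖u‖ = 1) (hu' : ‖u'‖ = 1) (hd : ‖u - u'‖ < 1) :
    segment ℝ u u' ⊆ {x : V | 1 / 2 ≤ ‖x‖ ∧ ‖x‖ ≤ 3 / 2} := by
  rintro x ⟨a, b, ha, hb, hab, rfl⟩
  have ha' : a = 1 - b := by linarith
  constructor
  · -- `‖a u + b u'‖ ≥ max a b ≥ 1/2`
    have h1 : a • u + b • u' = u - b • (u - u') := by
      rw [ha', sub_smul, one_smul, smul_sub]; abel
    have h2 : a • u + b • u' = u' + a • (u - u') := by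
      have hb' : b = 1 - a := by linarith
      rw [hb', sub_smul, one_smul, smul_sub]; abel
    have hbd : ‖b • (u - u')‖ ≤ b := by
      rw [norm_smul, Real.norm_eq_abs, abs_of_nonneg hb]
      nlinarith [norm_nonneg (u - u')]
    have had : ‖a • (u - u')‖ ≤ a := by
      rw [norm_smul, Real.norm_eq_abs, abs_of_nonneg ha]
      nlinarith [norm_nonneg (u - u')]
    have hx1 : a ≤ ‖a • u + b • u'‖ := by
      have h := norm_sub_norm_le u (b • (u - u'))
      rw [← h1, hu] at h
      linarith
    have hx2 : b ≤ ‖a • u + b • u'‖ := by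
      have h := norm_sub_le (u' + a • (u - u')) (a • (u - u'))
      rw [add_sub_cancel_right, hu', ← h2] at h
      linarith
    rcases le_total a b with hle | hle
    · linarith
    · linarith
  · calc ‖a • u + b • u'‖ ≤ ‖a • u‖ + ‖b • u'‖ := norm_add_le _ _
      _ = a + b := by rw [norm_smul, norm_smul, Real.norm_eq_abs, Real.norm_eq_abs,
          abs_of_nonneg ha, abs_of_nonneg hb, hu, hu', mul_one, mul_one]
      _ = 1 := hab
      _ ≤ 3 / 2 := by norm_num

/-- The shell `{1/2 ≤ ‖x‖ ≤ 3/2}` is compact. [folklore] -/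
theorem isCompact_shell : IsCompact {x : V | 1 / 2 ≤ ‖x‖ ∧ ‖x‖ ≤ 3 / 2} := by
  haveI : ProperSpace V := FiniteDimensional.proper ℝ V
  apply Metric.isCompact_of_isClosed_isBounded
  · exact (isClosed_le continuous_const continuous_norm).inter
      (isClosed_le continuous_norm continuous_const)
  · rw [Metric.isBounded_iff_subset_closedBall (0 : V)]
    exact ⟨3 / 2, fun x hx ↦ by rw [mem_closedBall, dist_zero_right]; exact hx.2⟩

/-- **Small Lipschitz constants of the slices near `σ = 1`.** Let `Φ : ℝ × V → W` be `C¹` on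
`(1-ε, 1+ε) × (V ∖ {0})` with `Φ(1, u) = 0` for `u ≠ 0`. Then for every `κ > 0` there is
`ε₁ ∈ (0, ε)` such that `‖Φ(σ, u') - Φ(σ, u)‖ ≤ κ‖u' - u‖` whenever `|σ - 1| ≤ ε₁` and `u, u'`
are unit vectors with `‖u - u'‖ < 1`. [folklore] -/
theorem exists_forall_slice_sub_le_near_one {Φ : ℝ × V → W} {ε : ℝ} (hε : 0 < ε)
    (hΦ : ContDiffOn ℝ 1 Φ (Ioo (1 - ε) (1 + ε) ×ˢ {u : V | u ≠ 0}))
    (h0 : ∀ u : V, u ≠ 0 → Φ (1, u) = 0) {κ : ℝ} (hκ : 0 < κ) :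
    ∃ ε₁ : ℝ, 0 < ε₁ ∧ ε₁ < ε ∧ ∀ σ : ℝ, |σ - 1| ≤ ε₁ → ∀ u u' : V, ‖u‖ = 1 → ‖u'‖ = 1 →
      ‖u - u'‖ < 1 → ‖Φ (σ, u') - Φ (σ, u)‖ ≤ κ * ‖u' - u‖ := by
  set O : Set (ℝ × V) := Ioo (1 - ε) (1 + ε) ×ˢ {u : V | u ≠ 0} with hO
  have hOo : IsOpen O := isOpen_Ioo.prod isOpen_ne
  -- the `u`-derivative `g(σ, u) = DΦ(σ, u) ∘ inr`
  set g : ℝ × V → V →L[ℝ] W := fun q ↦ (fderiv ℝ Φ q).comp (ContinuousLinearMap.inr ℝ ℝ V)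
    with hg
  have hgc : ContinuousOn g O :=
    (hΦ.continuousOn_fderiv_of_isOpen hOo le_rfl).clm_comp continuousOn_const
  -- the slices have derivative `g`
  have hslice : ∀ q ∈ O, HasFDerivAt (fun u : V ↦ Φ (q.1, u)) (g q) q.2 := by
    rintro ⟨σ, u⟩ hq
    have hd : DifferentiableAt ℝ Φ (σ, u) := (hΦ.differentiableOn one_ne_zero).differentiableAt
      (hOo.mem_nhds hq)
    exact hd.hasFDerivAt.comp u (hasFDerivAt_prodMk_right σ u)
  -- `g(1, u) = 0` for `u ≠ 0`
  have hg0 : ∀ u ∈ {x : V | 1 / 2 ≤ ‖x‖ ∧ ‖x‖ ≤ 3 / 2}, g (1, u) = 0 := by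
    intro u hu
    have hu0 : u ≠ 0 := by
      intro h
      have h1 := hu.1
      rw [h, norm_zero] at h1
      linarith
    have hmem : ((1 : ℝ), u) ∈ O := ⟨⟨by linarith, by linarith⟩, hu0⟩
    have h1 := hslice _ hmem
    have h2 : HasFDerivAt (fun u : V ↦ Φ (1, u)) (0 : V →L[ℝ] W) u := by
      have hev : (fun u : V ↦ Φ (1, u)) =ᶠ[𝓝 u] fun _ ↦ 0 := by
        filter_upwards [isOpen_ne.mem_nhds hu0] with v hv
        exact h0 v hv
      exact (hasFDerivAt_const (0 : W) u).congr_of_eventuallyEq hev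
    exact h1.unique h2
  -- uniform smallness of `g` on `[1 - ε₁, 1 + ε₁] × shell`
  have hε2 : 0 < ε / 2 := by linarith
  have hgc' : ContinuousOn g (Icc (1 - ε / 2) (1 + ε / 2) ×ˢ {x : V | 1 / 2 ≤ ‖x‖ ∧ ‖x‖ ≤ 3 / 2}) := by
    refine hgc.mono ?_
    rintro ⟨σ, u⟩ ⟨hσ, hu⟩
    refine ⟨⟨by linarith [hσ.1], by linarith [hσ.2]⟩, ?_⟩
    intro h
    have h1 : 1 / 2 ≤ ‖u‖ := hu.1
    have h2 : u = 0 := h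
    rw [h2, norm_zero] at h1
    linarith
  obtain ⟨ε₁, hε₁, hε₁ε, hsmall⟩ :=
    exists_forall_norm_lt_near_one isCompact_shell hε2 hgc' hg0 hκ
  refine ⟨ε₁, hε₁, by linarith, ?_⟩
  intro σ hσ u u' hu hu' hd
  have hσO : σ ∈ Ioo (1 - ε) (1 + ε) :=
    ⟨by linarith [(abs_le.1 hσ).1], by linarith [(abs_le.1 hσ).2]⟩
  -- mean value inequality on the segment
  have hseg := segment_subset_shell hu hu' hd
  have hconv : Convex ℝ (segment ℝ u u') := convex_segment u u'
  have hder : ∀ x ∈ segment ℝ u u', HasFDerivWithinAt (fun v : V ↦ Φ (σ, v)) (g (σ, x))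
      (segment ℝ u u') x := by
    intro x hx
    have hx0 : x ≠ 0 := by
      intro h; have := (hseg hx).1; rw [h, norm_zero] at this; linarith
    exact (hslice (σ, x) ⟨hσO, hx0⟩).hasFDerivWithinAt
  have hbound : ∀ x ∈ segment ℝ u u', ‖g (σ, x)‖ ≤ κ := fun x hx ↦
    (hsmall σ hσ x (hseg hx)).le
  exact hconv.norm_image_sub_le_of_norm_hasFDerivWithin_le hder hbound
    (left_mem_segment ℝ u u') (right_mem_segment ℝ u u')

/-- **Bounded Lipschitz constants in `σ`.** Let `Φ : ℝ × V → W` be `C¹` on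
`(1-ε, 1+ε) × (V ∖ {0})`. Then there is `A ≥ 0` with `‖Φ(σ', u) - Φ(σ, u)‖ ≤ A |σ' - σ|` for
`σ, σ' ∈ [1-ε/2, 1+ε/2]` and unit `u` (the `σ`-derivative is bounded on the compact
`[1-ε/2, 1+ε/2] × sphere`; mean value inequality). [folklore] -/
theorem exists_forall_sub_le_mul_abs_sub {Φ : ℝ × V → W} {ε : ℝ} (hε : 0 < ε)
    (hΦ : ContDiffOn ℝ 1 Φ (Ioo (1 - ε) (1 + ε) ×ˢ {u : V | u ≠ 0})) :
    ∃ A : ℝ, 0 ≤ A ∧ ∀ σ ∈ Icc (1 - ε / 2) (1 + ε / 2), ∀ σ' ∈ Icc (1 - ε / 2) (1 + ε / 2),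
      ∀ u : V, ‖u‖ = 1 → ‖Φ (σ', u) - Φ (σ, u)‖ ≤ A * |σ' - σ| := by
  set O : Set (ℝ × V) := Ioo (1 - ε) (1 + ε) ×ˢ {u : V | u ≠ 0} with hO
  have hOo : IsOpen O := isOpen_Ioo.prod isOpen_ne
  -- the `σ`-derivative `h(σ, u) = DΦ(σ, u) ∘ inl`
  set h : ℝ × V → ℝ →L[ℝ] W := fun q ↦ (fderiv ℝ Φ q).comp (ContinuousLinearMap.inl ℝ ℝ V)
    with hh
  have hhc : ContinuousOn h O :=
    (hΦ.continuousOn_fderiv_of_isOpen hOo le_rfl).clm_comp continuousOn_const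
  have hslice : ∀ q ∈ O, HasFDerivAt (fun σ : ℝ ↦ Φ (σ, q.2)) (h q) q.1 := by
    rintro ⟨σ, u⟩ hq
    have hd : DifferentiableAt ℝ Φ (σ, u) := (hΦ.differentiableOn one_ne_zero).differentiableAt
      (hOo.mem_nhds hq)
    exact hd.hasFDerivAt.comp σ (hasFDerivAt_prodMk_left σ u)
  -- bound on the compact `[1 - ε/2, 1 + ε/2] × sphere`
  set K : Set (ℝ × V) := Icc (1 - ε / 2) (1 + ε / 2) ×ˢ Metric.sphere (0 : V) 1 with hK
  have hKc : IsCompact K := isCompact_Icc.prod (isCompact_sphere 0 1)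
  have hKO : K ⊆ O := by
    rintro ⟨σ, u⟩ ⟨hσ, hu⟩
    refine ⟨⟨by linarith [hσ.1], by linarith [hσ.2]⟩, ?_⟩
    intro h0
    have h1 : ‖u‖ = 1 := by simpa using hu
    have h2 : u = 0 := h0
    rw [h2, norm_zero] at h1
    exact zero_ne_one h1
  obtain ⟨A, hA⟩ := hKc.exists_bound_of_continuousOn (hhc.mono hKO)
  refine ⟨max A 0, le_max_right _ _, ?_⟩
  intro σ hσ σ' hσ' u hu
  have huS : u ∈ Metric.sphere (0 : V) 1 := by simpa using hu
  have hconv : Convex ℝ (Icc (1 - ε / 2) (1 + ε / 2)) := convex_Icc _ _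
  have hder : ∀ x ∈ Icc (1 - ε / 2) (1 + ε / 2), HasFDerivWithinAt (fun σ : ℝ ↦ Φ (σ, u)) (h (x, u))
      (Icc (1 - ε / 2) (1 + ε / 2)) x := fun x hx ↦
    (hslice (x, u) (hKO ⟨hx, huS⟩)).hasFDerivWithinAt
  have hbound : ∀ x ∈ Icc (1 - ε / 2) (1 + ε / 2), ‖h (x, u)‖ ≤ max A 0 := fun x hx ↦
    (hA _ ⟨hx, huS⟩).trans (le_max_left _ _)
  have hmvt := hconv.norm_image_sub_le_of_norm_hasFDerivWithin_le hder hbound hσ hσ'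
  rw [Real.norm_eq_abs] at hmvt
  exact hmvt

end Literature.Geometry.Riemannian

end
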